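import Literature.MathematicalPhysics.KineticTheory.LorentzGasPathIntegral
import HarnessLib

/-!
# The `n`-fold entrance parametrisation of scatterer centres (hit chains → path coordinates)
(trunk T-KINETIC; topic MathematicalPhysics/KineticTheory; proofs towards the core fact
`Literature.MathematicalPhysics.KineticTheory.gallavotti_lorentz_tendsto_dual` of `LorentzGasGallavotti`)

Gallavotti's change of variables `(c₁, …, cₙ) ↦ (u₁, ω₁, …, uₙ, ωₙ)` from the centres of the `n`
scatterers met by the light particle to the path coordinates (Golse 2012, proof of Thm. 2.1:
`dc₁⋯dc_j/j! = rʲ ∏ sin(βᵢ/2) dβᵢ/2 dτᵢ`; Spohn 1991 (8.132)–(8.133)), as an identity between the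
iterated integral over the centres (`Kinetic.iterLIntegral`, the evaluated Mecke integral) and the
iterated path integral (`Kinetic.pathLIntegral`): for functionals supported on hit chains,
`∫ dc₁ ⋯ ∫ dcₙ F[c₁,…,cₙ] = ε^{n(d-1)} ∫du₁dω₁ (v·ω₁)₊ ⋯ F[virtualCentres ε z (u, ω)]`
(`Kinetic.iterLIntegral_hitChain_eq_pathLIntegral`), by induction on `n` from the one-scatterer
entrance parametrisation `Kinetic.hardSphere_entranceParametrization` (named fact P4, consumed as a
hypothesis) and the inverse identities of `LorentzGasVirtualOrbit`.

## References

* F. Golse, *Recent results on the periodic Lorentz gas*, Springer Basel (2011), §2, proof of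
  Thm. 2.1 (arXiv:0906.0191).
* H. Spohn, *Large Scale Dynamics of Interacting Particles*, Springer (1991), (8.132)–(8.133).
-/

open MeasureTheory Metric Real Set Filter Topology
open scoped InnerProductSpace ENNReal

namespace Literature.MathematicalPhysics.KineticTheory

noncomputable section

section Geometry

variable {E : Type*} [NormedAddCommGroup E] [InnerProductSpace ℝ E]

/-- The across component is the distance to the line: `‖w⊥‖ ≤ dist c (x + tv)` for every `t`
(`w⊥ = (c - x) - a v ⊥ v`, Pythagoras). [folklore] -/
theorem norm_perp_le_dist (x : E) {v : E} (hv : v ≠ 0) (c : E) (t : ℝ) :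
    ‖(c - x) - (⟪c - x, v⟫_ℝ / ‖v‖ ^ 2) • v‖ ≤ dist c (x + t • v) := by
  have hv2 : ‖v‖ ^ 2 ≠ 0 := pow_ne_zero 2 (norm_ne_zero_iff.2 hv)
  set a : ℝ := ⟪c - x, v⟫_ℝ / ‖v‖ ^ 2 with ha
  set w : E := (c - x) - a • v with hw
  have hw0 : ⟪w, v⟫_ℝ = 0 := Literature.Analysis.FunctionSpaces.inner_perpComponent_eq_zero x v c
  have hw0' : ⟪v, w⟫_ℝ = 0 := by rw [real_inner_comm]; exact hw0
  have hdec : c - (x + t • v) = w + (a - t) • v := by rw [hw]; module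
  have hsq : ‖c - (x + t • v)‖ ^ 2 = ‖w‖ ^ 2 + (a - t) ^ 2 * ‖v‖ ^ 2 := by
    rw [hdec, ← real_inner_self_eq_norm_sq, inner_add_left, inner_add_right, inner_add_right,
      inner_smul_left, inner_smul_right, inner_smul_left, inner_smul_right,
      real_inner_self_eq_norm_sq, real_inner_self_eq_norm_sq, hw0, hw0']
    simp only [RCLike.conj_to_real, mul_zero, add_zero, zero_add]
    ring
  rw [dist_eq_norm]
  have h1 : ‖w‖ ^ 2 ≤ ‖c - (x + t • v)‖ ^ 2 := by
    rw [hsq]; nlinarith [sq_nonneg (a - t), sq_nonneg ‖v‖]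
  exact (pow_le_pow_iff_left₀ (norm_nonneg _) (norm_nonneg _) two_ne_zero).1 h1

/-- A point of the open tube satisfies the closed across-condition `‖w⊥‖ ≤ ε` (indeed `< ε`).
[folklore] -/
theorem norm_perp_lt_of_exists_dist_lt (x : E) {v : E} (hv : v ≠ 0) {ε : ℝ} {c : E}
    (hc : ∃ t : ℝ, dist c (x + t • v) < ε) :
    ‖(c - x) - (⟪c - x, v⟫_ℝ / ‖v‖ ^ 2) • v‖ < ε := by
  obtain ⟨t, ht⟩ := hc
  exact (norm_perp_le_dist x hv c t).trans_lt ht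

/-- **Parametrised centres lie in the open tube**: for `v ≠ 0`, `ε > 0` and a unit vector `ω` not
orthogonal to `v`, the centre `x + uv + εω` is within distance `< ε` of the line `x + ℝv` (at the
parameter `t = u + ε (ω·v)/‖v‖²`, the distance is `ε √(1 - (ω·v̂)²)`). [folklore] -/
theorem exists_dist_param_lt (x : E) {v : E} (hv : v ≠ 0) {ε : ℝ} (hε : 0 < ε) (u : ℝ)
    (ω : sphere (0 : E) 1) (hω : ⟪v, (ω : E)⟫_ℝ ≠ 0) :
    ∃ t : ℝ, dist (x + u • v + ε • (ω : E)) (x + t • v) < ε := by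
  have hvn : 0 < ‖v‖ := norm_pos_iff.2 hv
  have hv2 : ‖v‖ ^ 2 ≠ 0 := pow_ne_zero 2 hvn.ne'
  have hω1 : ‖(ω : E)‖ = 1 := norm_eq_of_mem_sphere ω
  refine ⟨u + ε * ⟪(ω : E), v⟫_ℝ / ‖v‖ ^ 2, ?_⟩
  have hdec : x + u • v + ε • (ω : E) - (x + (u + ε * ⟪(ω : E), v⟫_ℝ / ‖v‖ ^ 2) • v) =
      ε • ((ω : E) - (⟪(ω : E), v⟫_ℝ / ‖v‖ ^ 2) • v) := by
    rw [show ε * ⟪(ω : E), v⟫_ℝ / ‖v‖ ^ 2 = ε * (⟪(ω : E), v⟫_ℝ / ‖v‖ ^ 2) by ring]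
    module
  have hnorm : ‖(ω : E) - (⟪(ω : E), v⟫_ℝ / ‖v‖ ^ 2) • v‖ ^ 2 = 1 - ⟪(ω : E), v⟫_ℝ ^ 2 / ‖v‖ ^ 2 := by
    rw [← real_inner_self_eq_norm_sq, inner_sub_left, inner_sub_right, inner_sub_right,
      inner_smul_left, inner_smul_right, inner_smul_left, inner_smul_right,
      real_inner_self_eq_norm_sq, real_inner_self_eq_norm_sq, hω1, real_inner_comm v]
    simp only [RCLike.conj_to_real]
    field_simp
    ring
  have hω' : ⟪(ω : E), v⟫_ℝ ≠ 0 := by rwa [real_inner_comm]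
  have hlt : ‖(ω : E) - (⟪(ω : E), v⟫_ℝ / ‖v‖ ^ 2) • v‖ < 1 := by
    have h2 : ‖(ω : E) - (⟪(ω : E), v⟫_ℝ / ‖v‖ ^ 2) • v‖ ^ 2 < 1 := by
      rw [hnorm]
      have : 0 < ⟪(ω : E), v⟫_ℝ ^ 2 / ‖v‖ ^ 2 := by positivity
      linarith
    nlinarith [norm_nonneg ((ω : E) - (⟪(ω : E), v⟫_ℝ / ‖v‖ ^ 2) • v)]
  rw [dist_eq_norm, hdec, norm_smul, Real.norm_eq_abs, abs_of_pos hε]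
  calc ε * ‖(ω : E) - (⟪(ω : E), v⟫_ℝ / ‖v‖ ^ 2) • v‖ < ε * 1 :=
      mul_lt_mul_of_pos_left hlt hε
    _ = ε := mul_one ε

/-- **The hit state keeps the speed** on the open tube: the entrance normal is a unit vector
there, and `v ↦ v - 2(v·n)n` is an isometry for unit `n`. [folklore] -/
theorem norm_hitState_snd {x v : E} (hv : v ≠ 0) {ε : ℝ} (hε : 0 < ε) {c : E}
    (hc : ∃ t : ℝ, dist c (x + t • v) < ε) : ‖(hitState ε (x, v) c).2‖ = ‖v‖ := by
  have hn : ‖Literature.Analysis.FunctionSpaces.entryNormal x v ε c‖ = 1 :=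
    Literature.Analysis.FunctionSpaces.norm_entryNormal hv hε (norm_perp_lt_of_exists_dist_lt x hv hc).le
  have := Literature.Analysis.FunctionSpaces.norm_sub_two_mul_inner_smul v ⟨Literature.Analysis.FunctionSpaces.entryNormal x v ε c, mem_sphere_zero_iff_norm.2 hn⟩
  simpa [hitState] using this

end Geometry

/-! ## The `n`-fold entrance parametrisation -/

section Chain

universe u

variable {d : Type u} [Fintype d]

/-- **P4 in the other order of integration**: the one-scatterer entrance parametrisation with the
time integral outside (Tonelli; the integrand is measurable). [folklore] -/
theorem entranceParametrization_swap (hP4 : hardSphere_entranceParametrization.{u})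
    (x v : EuclideanSpace ℝ d) (hv : v ≠ 0) {ε : ℝ} (hε : 0 < ε)
    (g : EuclideanSpace ℝ d → ℝ≥0∞) (hg : Measurable g) :
    ∫⁻ t : ℝ, ∫⁻ ω : sphere (0 : EuclideanSpace ℝ d) 1, g (x + t • v + ε • (ω : EuclideanSpace ℝ d)) *
        ENNReal.ofReal (ε ^ (Fintype.card d - 1) * max ⟪v, (ω : EuclideanSpace ℝ d)⟫_ℝ 0)
          ∂KineticTheory.sphereMeasure =
      ∫⁻ c in {c : EuclideanSpace ℝ d | ∃ t : ℝ, dist c (x + t • v) < ε}, g c := by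
  have h := hP4 x v hv hε g hg
  rw [finrank_euclideanSpace] at h
  rw [← h]
  symm
  refine lintegral_lintegral_swap ?_
  refine Measurable.aemeasurable ?_
  refine (hg.comp ?_).mul ?_
  · exact ((measurable_const.add (measurable_snd.smul measurable_const)).add
      ((measurable_subtype_coe.comp measurable_fst).const_smul ε))
  · exact ENNReal.measurable_ofReal.comp (measurable_const.mul
      ((continuous_const.inner (continuous_subtype_val.comp continuous_fst)).measurable.max
        measurable_const))

/-- **The `n`-fold entrance parametrisation** (hit chains → path coordinates). Let P4 hold
(`Kinetic.hardSphere_entranceParametrization`), `ε > 0`, `z = (x, v)` with `v ≠ 0`, and let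
`G : List ℝ^d → [0, ∞]` be such that `y ↦ (𝟙{hit chain} G)(List.ofFn y)` is measurable on
`Fin n → ℝ^d`. Then the iterated integral over the centres of the functional restricted to hit
chains equals `ε^{n(d-1)}` times the iterated path integral of the functional evaluated at the
realising centres:
`∫dc₁⋯∫dcₙ 𝟙{hit chain}(c) G(c) = ε^{n(d-1)} ∫du₁dω₁(v·ω₁)₊⋯ (𝟙{hit chain} G)(virtualCentres ε z (u,ω))`
(Golse 2012, proof of Thm. 2.1; Spohn 1991 (8.132)–(8.133)). Induction on `n`: peel off `c₁`,
apply the induction hypothesis from the hit state `hitState ε z c₁` (same speed), then P4 to the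
resulting measurable function of `c₁`, which vanishes off the open tube, and recognise
`hitState`/`virtualCentres` of the parametrised centre (`hitState_param`, `virtualCentres_cons`).
[cite: Golse2011, Thm. 2.1 (proof: change of variables (c₁,…,c_j) ↦ (τ,β))] -/
theorem iterLIntegral_hitChain_eq_pathLIntegral (hP4 : hardSphere_entranceParametrization.{u})
    {ε : ℝ} (hε : 0 < ε) (n : ℕ) :
    ∀ (z : EuclideanSpace ℝ d × EuclideanSpace ℝ d), z.2 ≠ 0 →
      ∀ (G : List (EuclideanSpace ℝ d) → ℝ≥0∞),
        Measurable (fun y : Fin n → EuclideanSpace ℝ d =>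
          {l | IsHitChain ε z l}.indicator G (List.ofFn y)) →
        iterLIntegral (volume : Measure (EuclideanSpace ℝ d)) n ({l | IsHitChain ε z l}.indicator G) =
          ENNReal.ofReal (ε ^ (Fintype.card d - 1)) ^ n *
            pathLIntegral z n (fun p => {l | IsHitChain ε z l}.indicator G (Literature.Analysis.FunctionSpaces.virtualCentres ε z p)) := by
  induction n with
  | zero =>
    intro z hv G hG
    simp [iterLIntegral_zero, pathLIntegral_zero, Literature.Analysis.FunctionSpaces.virtualCentres_nil]
  | succ n ih =>
    intro z hv G hG
    rcases z with ⟨x, v⟩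
    replace hv : v ≠ 0 := hv
    set F : List (EuclideanSpace ℝ d) → ℝ≥0∞ := {l | IsHitChain ε (x, v) l}.indicator G with hF
    -- the function of the first centre
    set g : EuclideanSpace ℝ d → ℝ≥0∞ := fun c =>
      iterLIntegral (volume : Measure (EuclideanSpace ℝ d)) n (fun l => F (c :: l)) with hg
    -- (1) `g` vanishes off the open tube and equals the induction hypothesis on it
    have hg_out : ∀ c, ¬ (∃ t : ℝ, dist c (x + t • v) < ε) → g c = 0 := fun c hc => by
      show iterLIntegral (volume : Measure (EuclideanSpace ℝ d)) n (fun l => F (c :: l)) = 0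
      rw [← iterLIntegral_zero_fun (volume : Measure (EuclideanSpace ℝ d)) n]
      refine iterLIntegral_congr _ _ fun l => ?_
      rw [hF, indicator_of_notMem]
      simp only [mem_setOf_eq, isHitChain_cons]
      exact fun h => hc h.1
    have hg_in : ∀ c, (∃ t : ℝ, dist c (x + t • v) < ε) → g c =
        ENNReal.ofReal (ε ^ (Fintype.card d - 1)) ^ n *
          pathLIntegral (hitState ε (x, v) c) n (fun p => {l | IsHitChain ε (hitState ε (x, v) c) l}.indicator
            (fun l => G (c :: l)) (Literature.Analysis.FunctionSpaces.virtualCentres ε (hitState ε (x, v) c) p)) := fun c hc => by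
      have hFc : ∀ l, F (c :: l) =
          {l | IsHitChain ε (hitState ε (x, v) c) l}.indicator (fun l => G (c :: l)) l := fun l => by
        rw [hF]
        simp only [indicator, mem_setOf_eq, isHitChain_cons]
        by_cases h : IsHitChain ε (hitState ε (x, v) c) l
        · rw [if_pos ⟨hc, h⟩, if_pos h]
        · rw [if_neg (fun h' => h h'.2), if_neg h]
      show iterLIntegral (volume : Measure (EuclideanSpace ℝ d)) n (fun l => F (c :: l)) = _
      rw [iterLIntegral_congr _ _ hFc]
      have hv' : (hitState ε (x, v) c).2 ≠ 0 := by
        rw [← norm_ne_zero_iff, norm_hitState_snd hv hε hc]; exact norm_ne_zero_iff.2 hv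
      refine ih _ hv' _ ?_
      -- measurability: a section of the measurable `y ↦ F (ofFn y)` on `Fin (n+1) → ℝ^d`
      have hsec : Measurable fun y : Fin n → EuclideanSpace ℝ d =>
          F (List.ofFn (Fin.cons c y : Fin (n + 1) → EuclideanSpace ℝ d)) := by
        set e := MeasurableEquiv.piFinSuccAbove (fun _ : Fin (n + 1) => EuclideanSpace ℝ d) 0
        have h1 : Measurable fun y : Fin n → EuclideanSpace ℝ d => e.symm (c, y) :=
          e.symm.measurable.comp (measurable_const.prodMk measurable_id)
        have h2 := hG.comp h1
        have hsymm : ∀ y : Fin n → EuclideanSpace ℝ d, e.symm (c, y) = Fin.cons c y := fun y =>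
          Fin.insertNth_zero' c y
        simpa only [Function.comp_def, hsymm] using h2
      have hofFn : ∀ y : Fin n → EuclideanSpace ℝ d,
          List.ofFn (Fin.cons c y : Fin (n + 1) → EuclideanSpace ℝ d) = c :: List.ofFn y :=
        fun y => by rw [List.ofFn_succ]; simp
      simp_rw [hofFn, hFc] at hsec
      exact hsec
    -- (2) measurability of `g` (a parametric product integral)
    have hgm : Measurable g := by
      have heq : ∀ c, g c = ∫⁻ y : Fin n → EuclideanSpace ℝ d,
          F (List.ofFn (Fin.cons c y : Fin (n + 1) → EuclideanSpace ℝ d))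
            ∂(Measure.pi fun _ => volume) := fun c => by
        show iterLIntegral (volume : Measure (EuclideanSpace ℝ d)) n (fun l => F (c :: l)) = _
        have hofFn : ∀ y : Fin n → EuclideanSpace ℝ d,
            List.ofFn (Fin.cons c y : Fin (n + 1) → EuclideanSpace ℝ d) = c :: List.ofFn y :=
          fun y => by rw [List.ofFn_succ]; simp
        simp_rw [hofFn]
        refine (lintegral_pi_ofFn volume n (fun l => F (c :: l)) ?_).symm
        -- measurability of the section (as above)
        set e := MeasurableEquiv.piFinSuccAbove (fun _ : Fin (n + 1) => EuclideanSpace ℝ d) 0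
        have h1 : Measurable fun y : Fin n → EuclideanSpace ℝ d => e.symm (c, y) :=
          e.symm.measurable.comp (measurable_const.prodMk measurable_id)
        have h2 := hG.comp h1
        have hsymm : ∀ y : Fin n → EuclideanSpace ℝ d, e.symm (c, y) = Fin.cons c y := fun y =>
          Fin.insertNth_zero' c y
        have h3 : Measurable fun y : Fin n → EuclideanSpace ℝ d =>
            F (List.ofFn (Fin.cons c y : Fin (n + 1) → EuclideanSpace ℝ d)) := by
          simpa only [Function.comp_def, hsymm] using h2
        simp_rw [hofFn] at h3
        exact h3
      rw [show g = fun c => ∫⁻ y : Fin n → EuclideanSpace ℝ d,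
          F (List.ofFn (Fin.cons c y : Fin (n + 1) → EuclideanSpace ℝ d))
            ∂(Measure.pi fun _ => volume) from funext heq]
      -- joint measurability of `(c, y) ↦ F (ofFn (cons c y))`
      set e := MeasurableEquiv.piFinSuccAbove (fun _ : Fin (n + 1) => EuclideanSpace ℝ d) 0
      have hsymm : ∀ (c : EuclideanSpace ℝ d) (y : Fin n → EuclideanSpace ℝ d),
          e.symm (c, y) = Fin.cons c y := fun c y => Fin.insertNth_zero' c y
      have hj : Measurable fun q : EuclideanSpace ℝ d × (Fin n → EuclideanSpace ℝ d) =>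
          F (List.ofFn (Fin.cons q.1 q.2 : Fin (n + 1) → EuclideanSpace ℝ d)) := by
        have h2 := hG.comp e.symm.measurable
        have : (fun q : EuclideanSpace ℝ d × (Fin n → EuclideanSpace ℝ d) =>
            F (List.ofFn (Fin.cons q.1 q.2 : Fin (n + 1) → EuclideanSpace ℝ d))) =
            (fun y => F (List.ofFn y)) ∘ e.symm := by
          funext q; simp only [Function.comp_apply]; rw [← hsymm q.1 q.2]
        rw [this]; exact h2
      exact hj.lintegral_prod_right'
    -- (3) assemble: `∫ g = ∫_{tube} g = P4 = pathLIntegral`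
    rw [iterLIntegral_succ]
    change ∫⁻ c, g c = _
    have htube : ∫⁻ c, g c = ∫⁻ c in {c | ∃ t : ℝ, dist c (x + t • v) < ε}, g c := by
      rw [← lintegral_indicator]
      · refine lintegral_congr fun c => ?_
        by_cases hc : ∃ t : ℝ, dist c (x + t • v) < ε
        · rw [indicator_of_mem (show c ∈ {c : EuclideanSpace ℝ d | ∃ t : ℝ, dist c (x + t • v) < ε}
            from hc)]
        · rw [indicator_of_notMem (show c ∉ {c : EuclideanSpace ℝ d | ∃ t : ℝ,
            dist c (x + t • v) < ε} from hc), hg_out c hc]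
      · -- the open tube is measurable (open)
        have : {c : EuclideanSpace ℝ d | ∃ t : ℝ, dist c (x + t • v) < ε} =
            ⋃ t : ℝ, Metric.ball (x + t • v) ε := by
          ext c; simp [Metric.mem_ball]
        rw [this]
        exact (isOpen_iUnion fun t => Metric.isOpen_ball).measurableSet
    rw [htube, ← entranceParametrization_swap hP4 x v hv hε g hgm, pathLIntegral_succ,
      ← lintegral_const_mul' _ _ (ENNReal.pow_ne_top ENNReal.ofReal_ne_top)]
    refine lintegral_congr fun t => ?_
    rw [← lintegral_const_mul' _ _ (ENNReal.pow_ne_top ENNReal.ofReal_ne_top)]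
    refine lintegral_congr fun ω => ?_
    simp only
    by_cases hω : 0 < ⟪v, ((ω : sphere (0 : EuclideanSpace ℝ d) 1) : EuclideanSpace ℝ d)⟫_ℝ
    · have hc : ∃ t' : ℝ, dist (x + t • v + ε • (ω : EuclideanSpace ℝ d)) (x + t' • v) < ε :=
        exists_dist_param_lt x hv hε t ω hω.ne'
      rw [hg_in _ hc, hitState_param hv hε t ω hω, ENNReal.ofReal_mul (by positivity), pow_succ]
      -- the functionals agree: `virtualCentres_cons` and `isHitChain_cons`
      have hfun : (fun p => {l | IsHitChain ε (x + t • v, v - (2 * ⟪v, (ω : EuclideanSpace ℝ d)⟫_ℝ) •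
            (ω : EuclideanSpace ℝ d)) l}.indicator
            (fun l => G ((x + t • v + ε • (ω : EuclideanSpace ℝ d)) :: l))
            (Literature.Analysis.FunctionSpaces.virtualCentres ε (x + t • v, v - (2 * ⟪v, (ω : EuclideanSpace ℝ d)⟫_ℝ) •
              (ω : EuclideanSpace ℝ d)) p)) =
          (fun p => F (Literature.Analysis.FunctionSpaces.virtualCentres ε (x, v) ((t, ω) :: p))) := by
        funext p
        rw [Literature.Analysis.FunctionSpaces.virtualCentres_cons, hF]
        dsimp only
        by_cases h : IsHitChain ε (x + t • v, v - (2 * ⟪v, (ω : EuclideanSpace ℝ d)⟫_ℝ) •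
            (ω : EuclideanSpace ℝ d)) (Literature.Analysis.FunctionSpaces.virtualCentres ε (x + t • v, v - (2 * ⟪v,
              (ω : EuclideanSpace ℝ d)⟫_ℝ) • (ω : EuclideanSpace ℝ d)) p)
        · have hmem : (x + t • v + ε • (ω : EuclideanSpace ℝ d)) :: Literature.Analysis.FunctionSpaces.virtualCentres ε (x + t • v,
              v - (2 * ⟪v, (ω : EuclideanSpace ℝ d)⟫_ℝ) • (ω : EuclideanSpace ℝ d)) p ∈
              {l | IsHitChain ε (x, v) l} := by
            rw [mem_setOf_eq, isHitChain_cons, hitState_param hv hε t ω hω]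
            exact ⟨hc, h⟩
          rw [indicator_of_mem (show _ ∈ {l | IsHitChain ε (x + t • v, v - (2 * ⟪v,
            (ω : EuclideanSpace ℝ d)⟫_ℝ) • (ω : EuclideanSpace ℝ d)) l} from h), indicator_of_mem hmem]
        · have hnmem : (x + t • v + ε • (ω : EuclideanSpace ℝ d)) :: Literature.Analysis.FunctionSpaces.virtualCentres ε (x + t • v,
              v - (2 * ⟪v, (ω : EuclideanSpace ℝ d)⟫_ℝ) • (ω : EuclideanSpace ℝ d)) p ∉
              {l | IsHitChain ε (x, v) l} := by
            intro h'
            rw [mem_setOf_eq, isHitChain_cons, hitState_param hv hε t ω hω] at h'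
            exact h h'.2
          rw [indicator_of_notMem (show _ ∉ {l | IsHitChain ε (x + t • v, v - (2 * ⟪v,
            (ω : EuclideanSpace ℝ d)⟫_ℝ) • (ω : EuclideanSpace ℝ d)) l} from h),
            indicator_of_notMem hnmem]
      rw [hfun]
      ring
    · have h0 : max ⟪v, (ω : EuclideanSpace ℝ d)⟫_ℝ 0 = 0 := max_eq_right (not_lt.1 hω)
      simp [h0]

end Chain

end

end Literature.MathematicalPhysics.KineticTheory
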